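import Summits.Ventures.AbcSig.Rows.TemplateC2a
import Summits.Ventures.AbcSig.Levels.N298
import Summits.Ventures.AbcSig.Levels.N1192

/-!
# Venture AbcSig — ROW `C2aL149A45`: `xⁿ + 2^a·149^m·yⁿ = z²`, class `a 45` (GENERATED by plean/leanrow.py)

HONEST FRAMING. A row of a COMPUTATION cell (`pub-abcsig`); a CONDITIONAL theorem, no claim on ABC or any summit.
Hypotheses: `BS04Package` (CITED), `DataComplete` at levels [298, 1192] (COMPUTED, two-engine certified
level files), and the listed per-orbit exclusions `hX_…` (CITED — e.g. the cell's M6 Eisenstein certificates; the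
row's R5 cell names each). Everything else is kernel-checked (`Rows/TemplateC2a.lean`, `Levels/N….lean`). Exponent
range: prime `n ≥ 11`, `n ≠ 149`; `B = 2^a 149^m` with `a, m < n` (n-th-power free).
Row of record:  (sha256 ; SIGNED 2026-08-22T13:21:45Z by referee (ref-g9)); its R0: THEOREM (uses CITED arithmetic facts) for all primes n >= 11 with n coprime to 2384 — class: ROW REVISION rev. 2 (lead 12:03:41Z/12:16:08Z protocol; rev. 1 sign. Exponents left open by the row of record are excluded here via ; kernel-sieve residuals the row of record closes by a cell module (M6 Eisenstein / M4 Kraus certificates) appear as CITED hypotheses .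
-/

namespace Summit.Ventures.AbcSig

/-- Row `C2aL149A45` (see module docstring). -/
theorem row_C2aL149A45 (M : NewformModel) (hP : M.BS04Package)
    (hD298 : M.DataComplete 298 level298Orbits) (hD1192 : M.DataComplete 1192 level1192Orbits)
    (n : ℕ) (hn : n.Prime) (hmin : 11 ≤ n) (hnℓ : n ≠ 149) (a m : ℕ) (ha : a = 4 ∨ a = 5) (hm : 1 ≤ m) (han : a < n) (hmn : m < n)
    (hX_orbit_298_2 : n ∈ ([7, 11] : List ℕ) → M.Excludes 298 orbit_298_2 (famB (2 ^ a * 149 ^ m) n (fun _ _ => True)))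
    (x y z : ℤ) (hxy1 : x * y ≠ 1) (hxy2 : x * y ≠ -1) : ¬ IsPrimitiveSolution 1 (2 ^ a * 149 ^ m) 1 n x y z := by
  have hℓ : Nat.Prime 149 := by norm_num
  have h7 : 7 ≤ n := by omega
  have hS298 :=
    (level298_sieve n hn h7 (fun o => M.Excludes 298 o (famB (2 ^ a * 149 ^ m) n (fun _ _ => True))) (fun h => absurd h (by simp only [List.mem_cons, List.not_mem_nil, or_false]; omega)) hX_orbit_298_2 (fun h => absurd h (by simp only [List.mem_cons, List.not_mem_nil, or_false]; omega)))
  have hS1192 :=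
    (level1192_sieve n hn h7 (fun o => M.Excludes 1192 o (famB (2 ^ a * 149 ^ m) n (fun _ _ => True))))
  exact rowC2a_a45 149 hℓ (by norm_num) M hP n hn h7 hnℓ hD1192 hD298 a m ha hm han hmn
    hS1192
    hS298 x y z hxy1 hxy2

end Summit.Ventures.AbcSig
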